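import Summits.RiemannHypothesis.RiemannHypothesis.Theorems.TiltedLandingLaw421R2NodeDR

/-! # TiltedLandingLaw421R3Forms
SUPPORT module for crux `TiltedLandingLaw421` (stmt-RiemannHypothesis-24774), `--supports … --as helper` only: proves no stub, no crux; fully proved (no `sorry`).
W-08 ROUND-3 (director (CA328): REST keyed ONCE, seal-free — load-bearing text β(⊥) = `RhW08.SealSwap.ZRestTrkSHFR PBot`, node `RhW08.SealSwap.law421T_of_alphaFree`, NO α stub)
cut by tenure rh-tenure-earlyapp-1 g6 from the single rc-0 base `baseR3B-W08-C1-rh-idea-5-g24.lean` sha256 d40e31646095b7fde3065497986c3084cc5ea105967bb05e8f2cf722ca32e3b9 (C1 g24 base baseR3B-W08-C1-rh-idea-5-g24.lean d40e31646095b7fd): decl blocks byte-verbatim, base order, dependency closure of the roots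
{zRestTrkSHFR_iff_rate} minus every declaration already LANDED in the round-2 tree chain (#986 R2StSwap · #988 R2Ready · #991 R2TrkD · #994 R2NodeD · #998 R2NodeDR · #999 R2CoreP · #1000 R2FlatM).
K = kernel-checked lemmas about MODEL sockets (combs / polynomials), not ζ/Ξ. Typed ≠ proved; RH is not proved; 24774 OPEN. -/

namespace RhW08.StSwap

open RhIdea6.G17.W07C7 RhIdea6.G17.W07C7.Rev6 RhIdea6.G18.W07C8.Law421BirthS RhIdea6.G19.W07C11.Seam
open RhIdea6.G20.W07C12.Frac RhIdea6.G20.W07C12.StColP RhW07.C12.FieldSplit RhIdea6.G21.W07C13.TentMax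
open RhW07.C14.TwoSided RhW07.C14.Classes RhW07.C14.Lineage RhW07.C14.Booking
open RhW07.C13.Heredity RhIdea6.G22.W07C15pre.Injection RhW07.E3.Cell RhW07.E3.Lit

section LowestHeight

/-- §K.16a the LOWEST HEIGHT of the lineage `St` at level `j`: `sInf` of `|Im u|` over the level (`0` on an empty level). -/
noncomputable def lowH (St : StatePred) (η : ℝ) (f : ℂ → ℂ) (x₀ s hmax R Hs : ℝ) (B : ℕ) (j : ℕ) : ℝ :=
  sInf ((fun u : ℂ => |u.im|) '' {u : ℂ | St η f x₀ s hmax R Hs B j u})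

/-- (K) at level 0 the lowest height is the tree's `rootHeight`, by `rfl`. -/
theorem lowH_zero (St : StatePred) (η : ℝ) (f : ℂ → ℂ) (x₀ s hmax R Hs : ℝ) (B : ℕ) :
    lowH St η f x₀ s hmax R Hs B 0 = rootHeight St η f x₀ s hmax R Hs B := rfl

/-- (K) every state of the level sits at or above the lowest height. -/
theorem lowH_le {St : StatePred} {η : ℝ} {f : ℂ → ℂ} {x₀ s hmax R Hs : ℝ} {B j : ℕ} {u : ℂ} (hu : St η f x₀ s hmax R Hs B j u) :
    lowH St η f x₀ s hmax R Hs B j ≤ |u.im| :=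
  csInf_le ⟨0, fun _ ⟨_, _, hb⟩ => hb ▸ abs_nonneg _⟩ ⟨u, hu, rfl⟩

/-- (K) on a finite inhabited level of an upper-half-plane lineage the lowest height is ATTAINED at a lowest state. -/
theorem exists_isLowest_eq_lowH {St : StatePred} (hF : LevelFinite St) (hU : UpperStates St) {η : ℝ} {f : ℂ → ℂ} {x₀ s hmax R Hs : ℝ}
    {B : ℕ} (hE : EngineHyps5 2 η f x₀ s hmax R Hs B) {j : ℕ} {u : ℂ} (hu : St η f x₀ s hmax R Hs B j u) :
    ∃ v : ℂ, IsLowest St η f x₀ s hmax R Hs B j v ∧ |v.im| = lowH St η f x₀ s hmax R Hs B j := by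
  have hfin := (hF η f x₀ s hmax R Hs B hE j).image (fun u : ℂ => |u.im|)
  have hne : ((fun u : ℂ => |u.im|) '' {u : ℂ | St η f x₀ s hmax R Hs B j u}).Nonempty := ⟨_, ⟨u, hu, rfl⟩⟩
  obtain ⟨v, hv, heq⟩ := (Set.mem_image _ _ _).mp (Set.Nonempty.csInf_mem hne hfin)
  have h3 : |v.im| = lowH St η f x₀ s hmax R Hs B j := heq
  refine ⟨v, ⟨hv, fun w hw => ?_⟩, h3⟩
  have h1 : lowH St η f x₀ s hmax R Hs B j ≤ |w.im| := lowH_le hw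
  rw [abs_of_pos (hU η f x₀ s hmax R Hs B j w hw)] at h1
  rw [abs_of_pos (hU η f x₀ s hmax R Hs B j v hv)] at h3
  linarith

/-- (K) a lowest state of an upper-half-plane lineage sits exactly at the lowest height. -/
theorem abs_im_eq_lowH_of_isLowest {St : StatePred} (hU : UpperStates St) {η : ℝ} {f : ℂ → ℂ} {x₀ s hmax R Hs : ℝ} {B j : ℕ} {v : ℂ}
    (hv : IsLowest St η f x₀ s hmax R Hs B j v) : |v.im| = lowH St η f x₀ s hmax R Hs B j := by
  apply le_antisymm
  · refine le_csInf ⟨|v.im|, ⟨v, hv.1, rfl⟩⟩ ?_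
    rintro _ ⟨w, hw, rfl⟩
    show |v.im| ≤ |w.im|
    rw [abs_of_pos (hU η f x₀ s hmax R Hs B j v hv.1), abs_of_pos (hU η f x₀ s hmax R Hs B j w hw)]
    exact hv.2 w hw
  · exact lowH_le hv.1
end LowestHeight

section CanonicalToll

open Classical in
/-- §K.16a the number of CHARGED levels below `k` (as a real). -/
noncomputable def chargeCount (P St Ready : StatePred) (η : ℝ) (f : ℂ → ℂ) (x₀ s hmax R Hs : ℝ) (B : ℕ) (k : ℕ) : ℝ :=
  ∑ j ∈ Finset.range k, (if Charged P St Ready η f x₀ s hmax R Hs B j then (1 : ℝ) else 0)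

open Classical in
/-- (K) bookkeeping: `injected … k + Σ_{j<k}[Charged j] 𝟙_𝓔 j = chargeCount … k` (an injected level is a charged non-𝓔 level). -/
theorem injected_add_classSum (P St Ready : StatePred) (𝓔 : LevelClass) (η : ℝ) (f : ℂ → ℂ) (x₀ s hmax R Hs : ℝ) (B k : ℕ) :
    injected P St Ready 𝓔 η f x₀ s hmax R Hs B k
        + (∑ j ∈ Finset.range k, (if Charged P St Ready η f x₀ s hmax R Hs B j then (if 𝓔 η f x₀ s hmax R Hs B j then (1 : ℝ) else 0) else 0))
      = chargeCount P St Ready η f x₀ s hmax R Hs B k := by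
  unfold injected chargeCount
  rw [← Finset.sum_add_distrib]
  refine Finset.sum_congr rfl fun j _ => ?_
  by_cases hC : Charged P St Ready η f x₀ s hmax R Hs B j
  · by_cases hcl : 𝓔 η f x₀ s hmax R Hs B j
    · rw [if_neg (fun h => h.2 hcl), if_pos hC, if_pos hcl, if_pos hC]; ring
    · rw [if_pos ⟨hC, hcl⟩, if_pos hC, if_neg hcl, if_pos hC]; ring
  · rw [if_neg (fun h => hC h.1), if_neg hC, if_neg hC]; ring

open Classical in
/-- (K) splitting the stub's toll sum: `Σ[Charged](𝟙_𝓔 + lam/c) = Σ[Charged] 𝟙_𝓔 + Σ[Charged] lam/c`. -/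
theorem tollSum_split (P St Ready : StatePred) (𝓔 : LevelClass) (η : ℝ) (f : ℂ → ℂ) (x₀ s hmax R Hs : ℝ) (B : ℕ) (lam : ℕ → ℝ)
    (c : ℝ) (k : ℕ) :
    (∑ j ∈ Finset.range k, (if Charged P St Ready η f x₀ s hmax R Hs B j then
        (if 𝓔 η f x₀ s hmax R Hs B j then (1 : ℝ) else 0) + lam j / c else 0))
      = (∑ j ∈ Finset.range k, (if Charged P St Ready η f x₀ s hmax R Hs B j then (if 𝓔 η f x₀ s hmax R Hs B j then (1 : ℝ) else 0) else 0))
        + ∑ j ∈ Finset.range k, (if Charged P St Ready η f x₀ s hmax R Hs B j then lam j / c else 0) := by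
  rw [← Finset.sum_add_distrib]
  refine Finset.sum_congr rfl fun j _ => ?_
  by_cases hC : Charged P St Ready η f x₀ s hmax R Hs B j
  · rw [if_pos hC, if_pos hC, if_pos hC]
  · rw [if_neg hC, if_neg hC, if_neg hC, add_zero]

/-- (K, arithmetic) the settler clause rearranged: `max (ι − m) 0 + (S₁ + S₂) ≤ A₁ − m + A₂ ↔ (ι + S₁) + max (m − ι) 0 + S₂ ≤ A₁ + A₂`. -/
theorem max_settler_arith (ι m S₁ S₂ A₁ A₂ : ℝ) :
    max (ι - m) 0 + (S₁ + S₂) ≤ A₁ - m + A₂ ↔ (ι + S₁) + max (m - ι) 0 + S₂ ≤ A₁ + A₂ := by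
  rcases le_total ι m with h | h
  · rw [max_eq_right (by linarith), max_eq_left (by linarith)]
    constructor <;> intro h' <;> linarith
  · rw [max_eq_left (by linarith), max_eq_right (by linarith)]
    constructor <;> intro h' <;> linarith

open Classical in
/-- ★ (K) THE SETTLER CLAUSE OF THE TRUNCATED TWIN, REARRANGED (any toll sequence `lam`, any denominator `c`):
`σ_min k + Σ[Ch](𝟙_𝓔 + lam/c) ≤ heightBudget M St` ⟺ `chargeCount k + (M 0 − injected k)⁺ + Σ[Ch] lam/c ≤ (Hs/s)² + B + 1 + 4(hmax − rootHeight)/s`. -/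
theorem settler_iff (P St Ready : StatePred) (𝓔 : LevelClass) (M : LevelMeter) (η : ℝ) (f : ℂ → ℂ) (x₀ s hmax R Hs : ℝ) (B : ℕ)
    (lam : ℕ → ℝ) (c : ℝ) (k : ℕ) :
    sigmaMin P St Ready 𝓔 M η f x₀ s hmax R Hs B k
        + (∑ j ∈ Finset.range k, (if Charged P St Ready η f x₀ s hmax R Hs B j then
            (if 𝓔 η f x₀ s hmax R Hs B j then (1 : ℝ) else 0) + lam j / c else 0))
        ≤ heightBudget M St η f x₀ s hmax R Hs B
      ↔ chargeCount P St Ready η f x₀ s hmax R Hs B k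
          + max (M η f x₀ s hmax R Hs B 0 - injected P St Ready 𝓔 η f x₀ s hmax R Hs B k) 0
          + (∑ j ∈ Finset.range k, (if Charged P St Ready η f x₀ s hmax R Hs B j then lam j / c else 0))
        ≤ (Hs / s) ^ 2 + (B : ℝ) + 1 + 4 * (hmax - rootHeight St η f x₀ s hmax R Hs B) / s := by
  rw [tollSum_split, ← injected_add_classSum P St Ready 𝓔 η f x₀ s hmax R Hs B k]
  simp only [sigmaMin, heightBudget]
  exact max_settler_arith _ _ _ _ _ _

open Classical in
/-- ★★ §K.16a **THE CANONICAL FORM** of the truncated-settler signed REST (toll witness eliminated): per legal frame,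
(S♮) every charged level has an inhabited successor level, and for every `k`
`chargeCount k + (M 0 − injected k)⁺ + Σ_{j<k}[Charged j] max(−μs, lowH (j+1) − lowH j)/(μs) ≤ (Hs/s)² + B + 1 + 4(hmax − rootHeight)/s`. -/
def CanonRestGM (μ : ℝ) (P St Ready : StatePred) (𝓔 : LevelClass) (M : LevelMeter) : Prop :=
  ∀ (η : ℝ) (f : ℂ → ℂ) (x₀ s hmax R Hs : ℝ) (B : ℕ), EngineHyps5 2 η f x₀ s hmax R Hs B →
    (∀ j : ℕ, Charged P St Ready η f x₀ s hmax R Hs B j → ∃ u' : ℂ, St η f x₀ s hmax R Hs B (j + 1) u') ∧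
    ∀ k : ℕ, chargeCount P St Ready η f x₀ s hmax R Hs B k
        + max (M η f x₀ s hmax R Hs B 0 - injected P St Ready 𝓔 η f x₀ s hmax R Hs B k) 0
        + (∑ j ∈ Finset.range k, (if Charged P St Ready η f x₀ s hmax R Hs B j then
            max (-(μ * s)) (lowH St η f x₀ s hmax R Hs B (j + 1) - lowH St η f x₀ s hmax R Hs B j) / (μ * s) else 0))
      ≤ (Hs / s) ^ 2 + (B : ℝ) + 1 + 4 * (hmax - rootHeight St η f x₀ s hmax R Hs B) / s

/-- ★★★ §K.16a (K) **TRUNCATED TWIN ⟺ CANONICAL FORM** on any lineage with finite levels in the upper half-plane (`0 < μ`):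
(⇒) at a charged level the canonical toll is ≤ any admissible toll (apply (S) to a lowest state); (⇐) `lam j := max(−μs, lowH (j+1) − lowH j)` with a lowest
state of level `j+1` as the successor of every state of level `j`. -/
theorem restBudgetGF_min_iff_canon {μ : ℝ} (hμ : 0 < μ) {P St Ready : StatePred} (hF : LevelFinite St) (hU : UpperStates St)
    (𝓔 : LevelClass) (M : LevelMeter) :
    RhW08.Round2.RestBudgetGF μ P St Ready 𝓔 (sigmaMin P St Ready 𝓔 M) (heightBudget M St) M ↔ CanonRestGM μ P St Ready 𝓔 M := by
  classical
  constructor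
  · intro h η f x₀ s hmax R Hs B hE
    have hs : 0 < s := hE.2.2.2.1
    have hμs : 0 < μ * s := mul_pos hμ hs
    obtain ⟨lam, hL, hS, hB⟩ := h η f x₀ s hmax R Hs B hE
    refine ⟨fun j hC => ?_, fun k => ?_⟩
    · obtain ⟨v, hv, hnr, hnP⟩ := hC
      obtain ⟨u', hu', -⟩ := hS j ⟨v, hv, hnr, hnP⟩ v hv.1 hnr
      exact ⟨u', hu'⟩
    · have hterm : ∀ j ∈ Finset.range k,
          (if Charged P St Ready η f x₀ s hmax R Hs B j then
              max (-(μ * s)) (lowH St η f x₀ s hmax R Hs B (j + 1) - lowH St η f x₀ s hmax R Hs B j) / (μ * s) else 0)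
            ≤ (if Charged P St Ready η f x₀ s hmax R Hs B j then lam j / (μ * s) else 0) := by
        intro j _
        by_cases hC : Charged P St Ready η f x₀ s hmax R Hs B j
        · rw [if_pos hC, if_pos hC]
          apply div_le_div_of_nonneg_right _ hμs.le
          apply max_le (hL j)
          obtain ⟨v, hv, hnr, hnP⟩ := hC
          obtain ⟨u', hu', hle⟩ := hS j ⟨v, hv, hnr, hnP⟩ v hv.1 hnr
          have h1 : lowH St η f x₀ s hmax R Hs B (j + 1) ≤ |u'.im| := lowH_le hu'
          have h2 : |v.im| = lowH St η f x₀ s hmax R Hs B j := abs_im_eq_lowH_of_isLowest hU hv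
          linarith
        · rw [if_neg hC, if_neg hC]
      have hsum := Finset.sum_le_sum hterm
      have hBk := (settler_iff P St Ready 𝓔 M η f x₀ s hmax R Hs B lam (μ * s) k).1 (hB k)
      linarith
  · intro h η f x₀ s hmax R Hs B hE
    have hs : 0 < s := hE.2.2.2.1
    obtain ⟨hSn, hB⟩ := h η f x₀ s hmax R Hs B hE
    refine ⟨fun j => max (-(μ * s)) (lowH St η f x₀ s hmax R Hs B (j + 1) - lowH St η f x₀ s hmax R Hs B j),
      fun j => le_max_left _ _, fun j hC u hu _ => ?_, fun k => ?_⟩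
    · obtain ⟨w, hw⟩ := hSn j hC
      obtain ⟨v, hv, hveq⟩ := exists_isLowest_eq_lowH hF hU hE hw
      refine ⟨v, hv.1, ?_⟩
      have h1 : lowH St η f x₀ s hmax R Hs B j ≤ |u.im| := lowH_le hu
      have h2 := le_max_right (-(μ * s)) (lowH St η f x₀ s hmax R Hs B (j + 1) - lowH St η f x₀ s hmax R Hs B j)
      linarith
    · exact (settler_iff P St Ready 𝓔 M η f x₀ s hmax R Hs B _ (μ * s) k).2 (hB k)
end CanonicalToll

end RhW08.StSwap

namespace RhW08.SealSwap

open Complex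
open RhIdea6.G17.W07C7 RhIdea6.G17.W07C7.Rev6 RhIdea6.G18.W07C8.Law421BirthS RhIdea6.G19.W07C11.Seam
open RhIdea6.G20.W07C12.Frac RhIdea6.G20.W07C12.StColP RhW07.C12.FieldSplit RhIdea6.G21.W07C13.TentMax
open RhW07.C14.TwoSided RhW07.C14.Classes RhW07.C14.Lineage RhW07.C14.Booking
open RhW07.C13.Heredity RhIdea6.G22.W07C15pre.Injection RhW07.E3.Cell
open RhW07.E3.Lit
open RhW08.Round1 RhW08.StSwap RhW08.Round2

section Family

/-- §K.16b the round-2R CHARGE co-predicate with SEAL `Pσ`: sealed OR the tracked successor already sits `s/4` lower. (`PTrkS PSealC4` is `PTrkD`.) -/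
def PTrkS (Pσ : StatePred) : StatePred := POr Pσ (SuccOf (1 / 4) StTrkD)

/-- §K.16b the minimal settler of the family. (`SigmaMinTrkS PSealC4` is `SigmaMinTrkDR′`.) -/
noncomputable def SigmaMinTrkS (Pσ : StatePred) : LevelMeter := sigmaMin (PTrkS Pσ) StTrkD ReadyR2 EmptyTrkD (tentMeterTrkD (3 / 2))

/-- ★★ §K.16b **β(Pσ)** — signed tolls, stop Ready′, height purse, booked-root meter, seal `Pσ`. (`ZRestTrkSHFR PSealC4` IS the keyed stub `ZRestTrkDHFR′`.) -/
def ZRestTrkSHFR (Pσ : StatePred) : Prop :=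
  RestBudgetGF (1 / 4) (PTrkS Pσ) StTrkD ReadyR2 EmptyTrkD (SigmaMinTrkS Pσ) (heightBudget (tentMeterTrkD (3 / 2)) StTrkD) (tentMeterTrkD (3 / 2))
end Family

section Forms

/-- §K.16c the canonical form of β(Pσ) (generic `CanonRestGM` at the family's literals). -/
def CanonRestTrkS (Pσ : StatePred) : Prop := CanonRestGM (1 / 4) (PTrkS Pσ) StTrkD ReadyR2 EmptyTrkD (tentMeterTrkD (3 / 2))

/-- ★★★ §K.16c (K) `β(Pσ) ↔ CanonRestTrkS Pσ` (toll witness eliminated). -/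
theorem zRestTrkSHFR_iff_canon (Pσ : StatePred) : ZRestTrkSHFR Pσ ↔ CanonRestTrkS Pσ :=
  restBudgetGF_min_iff_canon (by norm_num) levelFinite_stTrkD upperStates_stTrkD _ _

/-- ★ (K) THE `s/4` FLOOR AT CHARGED LEVELS: a charged level (some lowest non-ready state is unsealed AND has no `s/4`-lower tracked successor) whose successor
level is inhabited satisfies `−s/4 < lowH (j+1) − lowH j` — so the `max (−μs) ·` of the canonical toll is inactive for this family. -/
theorem delta_gt_of_charged {Pσ : StatePred} {η : ℝ} {f : ℂ → ℂ} {x₀ s hmax R Hs : ℝ} {B : ℕ} (hE : EngineHyps5 2 η f x₀ s hmax R Hs B) {j : ℕ}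
    (hC : Charged (PTrkS Pσ) StTrkD ReadyR2 η f x₀ s hmax R Hs B j) (hne : ∃ u' : ℂ, StTrkD η f x₀ s hmax R Hs B (j + 1) u') :
    -(1 / 4 * s) < lowH StTrkD η f x₀ s hmax R Hs B (j + 1) - lowH StTrkD η f x₀ s hmax R Hs B j := by
  obtain ⟨v, hv, -, hnP⟩ := hC
  obtain ⟨u', hu'⟩ := hne
  obtain ⟨w, hw, hweq⟩ := exists_isLowest_eq_lowH levelFinite_stTrkD upperStates_stTrkD hE hu'
  have h1 : ¬ (|w.im| + 1 / 4 * s ≤ |v.im|) := fun h => hnP (Or.inr ⟨w, hw.1, h⟩)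
  have h2 : |v.im| = lowH StTrkD η f x₀ s hmax R Hs B j := abs_im_eq_lowH_of_isLowest upperStates_stTrkD hv
  rw [not_le] at h1
  linarith

open Classical in
/-- ★★ §K.16c the LITERAL (max-free) form of β(Pσ): (S♮) and, for every `k`,
`chargeCount k + (T₀ᴿ − injected k)⁺ + Σ_{j<k}[Charged j] 4 (lowH (j+1) − lowH j)/s ≤ (Hs/s)² + B + 1 + 4 (hmax − rootHeight)/s`. -/
def LitRestTrkS (Pσ : StatePred) : Prop :=
  ∀ (η : ℝ) (f : ℂ → ℂ) (x₀ s hmax R Hs : ℝ) (B : ℕ), EngineHyps5 2 η f x₀ s hmax R Hs B →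
    (∀ j : ℕ, Charged (PTrkS Pσ) StTrkD ReadyR2 η f x₀ s hmax R Hs B j → ∃ u' : ℂ, StTrkD η f x₀ s hmax R Hs B (j + 1) u') ∧
    ∀ k : ℕ, chargeCount (PTrkS Pσ) StTrkD ReadyR2 η f x₀ s hmax R Hs B k
        + max (tentMeterTrkD (3 / 2) η f x₀ s hmax R Hs B 0 - injected (PTrkS Pσ) StTrkD ReadyR2 EmptyTrkD η f x₀ s hmax R Hs B k) 0
        + (∑ j ∈ Finset.range k, (if Charged (PTrkS Pσ) StTrkD ReadyR2 η f x₀ s hmax R Hs B j then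
            4 * (lowH StTrkD η f x₀ s hmax R Hs B (j + 1) - lowH StTrkD η f x₀ s hmax R Hs B j) / s else 0))
      ≤ (Hs / s) ^ 2 + (B : ℝ) + 1 + 4 * (hmax - rootHeight StTrkD η f x₀ s hmax R Hs B) / s

open Classical in
/-- (K) under (S♮) the canonical and the literal toll sums agree term by term. -/
theorem tollSum_canon_eq_lit {Pσ : StatePred} {η : ℝ} {f : ℂ → ℂ} {x₀ s hmax R Hs : ℝ} {B : ℕ} (hE : EngineHyps5 2 η f x₀ s hmax R Hs B)
    (hSn : ∀ j : ℕ, Charged (PTrkS Pσ) StTrkD ReadyR2 η f x₀ s hmax R Hs B j → ∃ u' : ℂ, StTrkD η f x₀ s hmax R Hs B (j + 1) u') (k : ℕ) :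
    (∑ j ∈ Finset.range k, (if Charged (PTrkS Pσ) StTrkD ReadyR2 η f x₀ s hmax R Hs B j then
        max (-(1 / 4 * s)) (lowH StTrkD η f x₀ s hmax R Hs B (j + 1) - lowH StTrkD η f x₀ s hmax R Hs B j) / (1 / 4 * s) else 0))
      = ∑ j ∈ Finset.range k, (if Charged (PTrkS Pσ) StTrkD ReadyR2 η f x₀ s hmax R Hs B j then
        4 * (lowH StTrkD η f x₀ s hmax R Hs B (j + 1) - lowH StTrkD η f x₀ s hmax R Hs B j) / s else 0) := by
  have hs : 0 < s := hE.2.2.2.1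
  refine Finset.sum_congr rfl fun j _ => ?_
  by_cases hC : Charged (PTrkS Pσ) StTrkD ReadyR2 η f x₀ s hmax R Hs B j
  · rw [if_pos hC, if_pos hC, max_eq_right (le_of_lt (delta_gt_of_charged hE hC (hSn j hC)))]
    rw [div_eq_div_iff (mul_pos (by norm_num : (0 : ℝ) < 1 / 4) hs).ne' hs.ne']
    ring
  · rw [if_neg hC, if_neg hC]

/-- ★★ §K.16c (K) canonical ⟺ literal. -/
theorem canonRestTrkS_iff_lit (Pσ : StatePred) : CanonRestTrkS Pσ ↔ LitRestTrkS Pσ := by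
  classical
  constructor
  · intro h η f x₀ s hmax R Hs B hE
    obtain ⟨hSn, hB⟩ := h η f x₀ s hmax R Hs B hE
    refine ⟨hSn, fun k => ?_⟩
    rw [← tollSum_canon_eq_lit hE hSn k]
    exact hB k
  · intro h η f x₀ s hmax R Hs B hE
    obtain ⟨hSn, hB⟩ := h η f x₀ s hmax R Hs B hE
    refine ⟨hSn, fun k => ?_⟩
    have h1 := hB k
    rw [← tollSum_canon_eq_lit hE hSn k] at h1
    exact h1

open Classical in
/-- ★★★ §K.16c **THE RATE FORM** of β(Pσ) (telescoped; `rootHeight` cancels): (S♮) and, for every `k`,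
`chargeCount k + (T₀ᴿ − injected k)⁺ + 4·lowH k/s + Σ_{j<k}[¬Charged j] 4 (lowH j − lowH (j+1))/s ≤ (Hs/s)² + B + 1 + 4·hmax/s`
= «charged count + unspent root credit + current lowest tracked height/(s/4) + free-level drops/(s/4) ≤ LAW 421's depth purse». -/
def RateRestTrkS (Pσ : StatePred) : Prop :=
  ∀ (η : ℝ) (f : ℂ → ℂ) (x₀ s hmax R Hs : ℝ) (B : ℕ), EngineHyps5 2 η f x₀ s hmax R Hs B →
    (∀ j : ℕ, Charged (PTrkS Pσ) StTrkD ReadyR2 η f x₀ s hmax R Hs B j → ∃ u' : ℂ, StTrkD η f x₀ s hmax R Hs B (j + 1) u') ∧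
    ∀ k : ℕ, chargeCount (PTrkS Pσ) StTrkD ReadyR2 η f x₀ s hmax R Hs B k
        + max (tentMeterTrkD (3 / 2) η f x₀ s hmax R Hs B 0 - injected (PTrkS Pσ) StTrkD ReadyR2 EmptyTrkD η f x₀ s hmax R Hs B k) 0
        + 4 * lowH StTrkD η f x₀ s hmax R Hs B k / s
        + (∑ j ∈ Finset.range k, (if Charged (PTrkS Pσ) StTrkD ReadyR2 η f x₀ s hmax R Hs B j then 0 else
            4 * (lowH StTrkD η f x₀ s hmax R Hs B j - lowH StTrkD η f x₀ s hmax R Hs B (j + 1)) / s))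
      ≤ (Hs / s) ^ 2 + (B : ℝ) + 1 + 4 * hmax / s

open Classical in
/-- (K) telescoping: `Σ_{j<k}[Charged] 4Δ_j/s = 4·lowH k/s − 4·rootHeight/s + Σ_{j<k}[¬Charged] 4(lowH j − lowH (j+1))/s`. -/
theorem tollSum_lit_eq_rate (P : StatePred) (η : ℝ) (f : ℂ → ℂ) (x₀ s hmax R Hs : ℝ) (B k : ℕ) :
    (∑ j ∈ Finset.range k, (if Charged P StTrkD ReadyR2 η f x₀ s hmax R Hs B j then
        4 * (lowH StTrkD η f x₀ s hmax R Hs B (j + 1) - lowH StTrkD η f x₀ s hmax R Hs B j) / s else 0))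
      = 4 * lowH StTrkD η f x₀ s hmax R Hs B k / s - 4 * rootHeight StTrkD η f x₀ s hmax R Hs B / s
        + ∑ j ∈ Finset.range k, (if Charged P StTrkD ReadyR2 η f x₀ s hmax R Hs B j then 0 else
            4 * (lowH StTrkD η f x₀ s hmax R Hs B j - lowH StTrkD η f x₀ s hmax R Hs B (j + 1)) / s) := by
  have htel : (∑ j ∈ Finset.range k, (4 * lowH StTrkD η f x₀ s hmax R Hs B (j + 1) / s - 4 * lowH StTrkD η f x₀ s hmax R Hs B j / s))
      = 4 * lowH StTrkD η f x₀ s hmax R Hs B k / s - 4 * lowH StTrkD η f x₀ s hmax R Hs B 0 / s :=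
    Finset.sum_range_sub (fun j => 4 * lowH StTrkD η f x₀ s hmax R Hs B j / s) k
  rw [lowH_zero] at htel
  rw [← htel, ← Finset.sum_add_distrib]
  refine Finset.sum_congr rfl fun j _ => ?_
  by_cases hC : Charged P StTrkD ReadyR2 η f x₀ s hmax R Hs B j
  · rw [if_pos hC, if_pos hC]; ring
  · rw [if_neg hC, if_neg hC]; ring

/-- ★★ §K.16c (K) literal ⟺ rate. -/
theorem litRestTrkS_iff_rate (Pσ : StatePred) : LitRestTrkS Pσ ↔ RateRestTrkS Pσ := by
  classical
  constructor
  · intro h η f x₀ s hmax R Hs B hE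
    obtain ⟨hSn, hB⟩ := h η f x₀ s hmax R Hs B hE
    refine ⟨hSn, fun k => ?_⟩
    have h1 := hB k
    rw [tollSum_lit_eq_rate] at h1
    have h2 : 4 * (hmax - rootHeight StTrkD η f x₀ s hmax R Hs B) / s = 4 * hmax / s - 4 * rootHeight StTrkD η f x₀ s hmax R Hs B / s := by
      ring
    rw [h2] at h1
    linarith
  · intro h η f x₀ s hmax R Hs B hE
    obtain ⟨hSn, hB⟩ := h η f x₀ s hmax R Hs B hE
    refine ⟨hSn, fun k => ?_⟩
    have h1 := hB k
    rw [tollSum_lit_eq_rate]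
    have h2 : 4 * (hmax - rootHeight StTrkD η f x₀ s hmax R Hs B) / s = 4 * hmax / s - 4 * rootHeight StTrkD η f x₀ s hmax R Hs B / s := by
      ring
    rw [h2]
    linarith

/-- ★★★ §K.16c (K) β(Pσ) ⟺ RATE FORM. -/
theorem zRestTrkSHFR_iff_rate (Pσ : StatePred) : ZRestTrkSHFR Pσ ↔ RateRestTrkS Pσ :=
  ((zRestTrkSHFR_iff_canon Pσ).trans (canonRestTrkS_iff_lit Pσ)).trans (litRestTrkS_iff_rate Pσ)
end Forms

end RhW08.SealSwap
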